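import Literature.MathematicalPhysics.QuantumFieldTheory.Balaban1983to89.B2Lemma27Proof

/-!
# `Balaban1983to89.B2Ineq2114Model27` — [Balaban1982Higgs2] **(2.114)** p. 581 «Lemma 2.7 and the restrictions on the fields ψ, φ
# imply |φ′(x)| ≦ O(1)p(Lᵏε), x ∈ Λ₅^{(k)}» made HYPOTHESIS-FREE on the model family for which Lemma 2.7 is PROVED
# (`B2Lemma27Proof.Model27`, row B2.Lem2.7), with `ℝ^N`-valued fields

statement-level skeleton of published theorems with citation tags; proofs where landed; nothing here is a claim about the Yang–Mills mass gap

CITATION HEADER (lean-in-tree rule).  T. Bałaban, *(Higgs)₂,₃ quantum fields in a finite volume. II. An upper bound*, Commun.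
Math. Phys. **86** (1982) 555–594, doi:10.1007/bf01214890 [Balaban1982Higgs2] (cell paper B2; journal page = PDF page + 554;
p. 581 [PDF 27] and p. 560 [PDF 6] READ AS IMAGES on the ×2 renders `run/shared/lean/pub/pub-balaban/b2b-balaban-ref1/pages/
1982-cmp86-higgs23-II/1982-cmp86-higgs23-II-p027-x2.png`, `…-p006-x2.png`).  Cell `lit-balaban` (HOME `run/shared/lean/pub/lit-balaban/`),
reader/typer seat **r14** gen 22 (unit `lit-balaban-r14-g22`; free-target protocol G.5-34(d), TAKING line HOME/STATUS.md
2026-08-23T11:29Z); SKELETON row **B2.Eq2.114** (decl of record `…B2Sect2Statements.Ineq2114`, r02 p239259, UNCHANGED; fold owner r02;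
cells only — whether the head moves is the owner's / the lead's call).  USED BY NAME, never restated: p23 gen 5's
`B2Lemma27Proof.{Frame27, Model27, Model27.Restr, Model27.objΩ, Model27.target, Model27.dev2113, famOf27, lemma27Printed_model,
lemma27_bound}` (row B2.Lem2.7, head `proved p252891`), the decl of record `B2Sect2Statements.Ineq2114` (r02) as the LITERAL
conclusion, b04s' transporters `B4Lower18Regular.transport_fieldLink`, `B4GaugeCovariance.OrthFlow`; p23 gen 4's `B2Ineq2114Proof`
(schematic family, one real component; `ineq2114_of_lemma27` = «Lemma 2.7 AS TYPED ⇒ (2.114) AS TYPED» for ALL schematic instances)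
is the pattern followed, not imported (its lemmas are about real-valued fields).

WHAT IS PRINTED (verbatim, p. 581 [PDF 27]).  *"To obtain small fields on the set Λ₅^{(k)} we make the translation
φ = φ′ + aL⁻²C^{(k)}_{Λ₄^{(k)}}(Bᵏ(Λ₂^{(k)}), B^{(k+1),η})Q*(B^{(k+1),η})ψ. (2.110) […] **Lemma 2.7.** The following estimate holds
aL⁻²(C^{(k)}_{Λ₄^{(k)}}(Bᵏ(Λ₂^{(k)}), B^{(k+1),η})Q*(B^{(k+1),η})ψ)(x) = (Q*(B^{(k+1),η})ψ)(x) + O(p(Lᵏε)), x ∈ Λ₅^{(k)}. (2.113) […] Lemma 2.7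
and the restrictions on the fields ψ, φ imply |φ′(x)| ≦ O(1)p(Lᵏε), x ∈ Λ₅^{(k)}. (2.114)"*; the restriction used is (2.16)₁ p. 560
[PDF 6] *"|ψ(y) − U(A(Γ_{y,x}))φ(x)| ≦ 2Ldp(ε) for x ∈ B(y)"* with *"The same estimates as (2.16), (2.17) will hold for the fields in
each step with ε replaced by the corresponding Lᵏε."*

WHY THIS FILE (the row's status cell, ROWS-B2 v2.179): «typed p239259 · proved p247861 (DERIVED from the typed antecedent B2.Lem2.7 + (2.16)₁:
`B2Ineq2114Proof.ineq2114_of_lemma27`, model family of (2.110) …) · the typed antecedent B2.Lem2.7 is now PROVED FOR THE MODEL FAMILY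
p252891 (p23 g5; qualified reconstruction) — so `ineq2114_of_lemma27` rests on a proved-for-model input; head unchanged».  But
`ineq2114_of_lemma27` needs `Lemma27Printed` for the family of ALL schematic instances `B2Ineq2114Proof.Model X` (arbitrary
numbers `CQsψ`, `Qsψ`), which is not what p252891 proves; p252891 proves `Lemma27Printed (famOf27 fr Yo)` for the CONCRETE family
`Model27 fr Yo`.  This file performs the composition IN THE KERNEL on that concrete family: the index type is `Model2114 fr Yo` =
a `Model27` instance + the old field `φ` (values in `ℝ^ι`, so `|·|` is the Euclidean site norm — the owner's class-(C) note
«one-real-component reading of Q*» does not apply here), `φ′ := φ − aL⁻²C^{(k)}_{Λ₄}(…)Q*ψ` ((2.110); the subtrahend is p23's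
`Model27.objΩ`), the restriction (2.16)₁ at scale `Lᵏε` LITERALLY as printed (`Restr216`: `|ψ(z₀) − U(B̃(Γ′_{z₀,y}))φ(y)| ≤ c₂·p`
for the unit sites `y ∈ B(z₀)`, `c₂` ↤ `2Ld`), and the decl of record `B2Sect2Statements.Ineq2114` is PROVED for that family
— once FROM `Lemma27Printed (famOf27 fr Yo)` by name (print's sentence as an implication, `ineq2114_of_lemma27_model27`), once
HYPOTHESIS-FREE through p23's `lemma27Printed_model` (`ineq2114_model27`, `ineq2114_model27_printed` at `c₂ := 2Ld`).

THE ARGUMENT (print's one line).  At a unit site `y ∈ B(z₀) ⊂ Λ₅^{(k)}`: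
`|φ′(y)| ≤ |φ(y) − (Q*(B̃)ψ)(y)| + |(Q*(B̃)ψ)(y) − aL⁻²(C^{(k)}_{Λ₄}(…)Q*(B̃)ψ)(y)| ≤ c₂·p + C·p`, the first term being (2.16)₁
read through the orthogonality of the transporter (`|ψ(z₀) − Uφ(y)| = |Uᵀψ(z₀) − φ(y)|`, `siteNorm_restr216_eq`), the second Lemma 2.7.

WHAT THIS FILE PROVES (kernel-checked, zero `sorry`; 1 structure + 4 definitions WITH BODIES (`Model2114`; `phi'`, `Restr216`,
`Restr`, `supφ'`), theorems; NO `Prop`-valued fact; axioms standard).  DATA DISCIPLINE: `Model2114` adds to `Model27` exactly ONE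
field, the DATA `φ` (no hypothesis field, no analytic input); the analytic inputs are `Model27`'s own printed-shape fields under
p252891's qualification, unchanged; the two restriction predicates (`Model27.Restr`, `Restr216`) are the HYPOTHESES of the
family statement, as print's «the restrictions on the fields ψ, φ» are the antecedent of (2.114).  `siteNorm_restr216_eq` (orthogonality), `phi'_site_le`
((2.114) at a site from the two inputs), `supφ'_le`, `supφ'_le_explicit` (`≤ (c₂ + K₃C27)·p` from p23's `lemma27_bound`),
**`ineq2114_of_lemma27_model27`** (`Lemma27Printed (famOf27 fr Yo) → Ineq2114 …`, O(1) = `c₂ + C⁺`), **`ineq2114_model27`**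
(hypothesis-free), `ineq2114_model27_printed` (`c₂ := 2Ld`, i.e. `2(ℓ+1)(d+1)` on the model's `(d+1)`-dimensional unit lattice
with block side `ℓ+1`).

HONEST SCOPE / DIFFERENCES FROM PRINT (recorded, not hidden).  (a) MODEL INSTANCE: the family is p23's `Model27` (one step `k`,
one coarse point `z₀` of Λ₅^{(k)}, the B4-lineage box with its printed-shape INPUT fields — Prop. I.2.3 shapes on Λ₄, Prop. I.2.2
in operator form, the (2.16)₃/(2.16)₄ ψ-restrictions in integrated form, the scale products, the proviso `hsmall`) — exactly the
standing of row B2.Lem2.7's head `proved p252891` («qualified reconstruction»), no more: (2.114) holds here for every instance of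
that family, uniformly (one O(1) per frame), not for the (Higgs)₂,₃ carrier of record (`HiggsLattice`), on which Lemma 2.7 has no
member yet.  (b) `c₂ ≥ 0` is a free letter (print `2Ld`); the printed instance is `ineq2114_model27_printed`.  (c) «x ∈ Λ₅^{(k)}»
is rendered, as in `Model27`, by the unit sites of ONE block `B(z₀)`, `z₀ ∈ Λ₅^{(k)′}` a datum of the instance; the supremum
`supφ'` is over that block (print's O(1) is uniform in x, so the per-block form is equivalent).  (d) Nothing minted: the constant is
p23's `K₃·C27` (resp. the `C` of the hypothesis); no new `Prop` fact; p23's files untouched.  NOT summit progress.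
-/

noncomputable section

namespace Literature.MathematicalPhysics.QuantumFieldTheory.Balaban1983to89.B2Ineq2114Model27

open Matrix
open Literature.MathematicalPhysics.QuantumFieldTheory.Balaban1983to89.B4GaugeCovariance
open Literature.MathematicalPhysics.QuantumFieldTheory.Balaban1983to89.B4Lower18Regular (lsum transport_fieldLink)
open Literature.MathematicalPhysics.QuantumFieldTheory.Balaban1983to89.B4Lemma21Region (siteNorm)
open Literature.MathematicalPhysics.QuantumFieldTheory.Balaban1983to89.B4Reflection242 (boxDom)
open Literature.MathematicalPhysics.QuantumFieldTheory.Balaban1983to89.B4Lemma22Reduce231 (siteNorm_add_le siteNorm_nonneg)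
open Literature.MathematicalPhysics.QuantumFieldTheory.Balaban1983to89.B4Lemma22ReduceDeriv (siteNorm_flow)
open Literature.MathematicalPhysics.QuantumFieldTheory.Balaban1983to89.B4Lemma22PertVSup (siteNorm_neg)
open Literature.MathematicalPhysics.QuantumFieldTheory.Balaban1983to89.B2Lemma27CovarianceBox (transU cSite M2)
open Literature.MathematicalPhysics.QuantumFieldTheory.Balaban1983to89.B2Lemma27Proof (Frame27 Model27 famOf27
  lemma27Printed_model lemma27_bound)

variable {ι : Type} [Fintype ι] [DecidableEq ι] {d : ℕ}

/-- ONE INSTANCE of (2.114): an instance of p23's Lemma-2.7 model `Model27` (step `k`, coarse point `z₀ ∈ Λ₅^{(k)′}`, the field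
`ψ`, the box data, `B̃ = B^{(k+1),η}`) TOGETHER WITH the old scalar field `φ` at the unit sites of the box (only its values on the
block `B(z₀)` enter).  [cite: Balaban1982Higgs2, (2.110) p. 580, (2.114) p. 581] -/
structure Model2114 (fr : Frame27 ι d) (Yo : Type) [Fintype Yo] [DecidableEq Yo] extends Model27 fr Yo where
  /-- the old field `φ` (values in `ℝ^ι`) at the unit sites of the box -/
  φ : ↥(boxDom (M2 fr.ℓ M')) → ι → ℝ

namespace Model2114

variable {fr : Frame27 ι d} {Yo : Type} [Fintype Yo] [DecidableEq Yo] (m : Model2114 fr Yo)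

/-- **(2.110)** p. 580: `φ′(y) = φ(y) − (aL⁻²C^{(k)}_{Λ₄^{(k)}}(Bᵏ(Λ₂^{(k)}), B^{(k+1),η})Q*(B^{(k+1),η})ψ)(y)` at a unit site `y` — the
subtrahend is p23's `Model27.objΩ y` (the left side of (2.113) in kernel form). [cite: Balaban1982Higgs2, (2.110) p. 580] -/
def phi' (y : ↥(boxDom (M2 fr.ℓ m.M'))) : ι → ℝ := m.φ y - m.objΩ y

/-- **THE RESTRICTION (2.16)₁ ON THE PAIR (ψ, φ) AT SCALE `Lᵏε`, LITERALLY**: «|ψ(y) − U(A(Γ_{y,x}))φ(x)| ≦ 2Ldp(ε) for x ∈ B(y)»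
(p. 560; «the same estimates … hold for the fields in each step with ε replaced by the corresponding Lᵏε») with `y ↦ z₀`,
`x ↦` the unit site `y ∈ B(z₀)`, `A ↦ B̃ = B^{(k+1),η}` (`Model27.At`), the transporter `U(B̃(Γ′_{z₀,y}))` = `transU … z₀ y`, and
`2Ld ↦ c₂`. [cite: Balaban1982Higgs2, (2.16) p. 560, p. 581 «the restrictions on the fields ψ, φ»] -/
def Restr216 (c₂ : ℝ) : Prop :=
  ∀ y : ↥(boxDom (M2 fr.ℓ m.M')), cSite d fr.ℓ m.M' y = m.z₀ →
    siteNorm (m.ψ m.z₀ - transU d fr.F m.κ fr.ℓ m.k m.M' m.emb' m.Γ' m.At m.z₀ y *ᵥ m.φ y) ≤ c₂ * m.p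

/-- «the restrictions on the fields ψ, φ» of (2.114): p23's `Model27.Restr` on `ψ` ((2.16)₃,₄ at scale `Lᵏε`, integrated form)
AND (2.16)₁ for the pair `(ψ, φ)`. [cite: Balaban1982Higgs2, (2.16) p. 560, (2.114) p. 581] -/
def Restr (c₂ : ℝ) : Prop := m.toModel27.Restr ∧ m.Restr216 c₂

/-- `sup_{y ∈ B(z₀)} |φ′(y)|` (Euclidean site norm) — the real `supφ'` of the decl of record `B2Sect2Statements.Ineq2114` for this
instance. [cite: Balaban1982Higgs2, (2.114) p. 581] -/
def supφ' : ℝ :=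
  ⨆ y : {y : ↥(boxDom (M2 fr.ℓ m.M')) // cSite d fr.ℓ m.M' y = m.z₀}, siteNorm (m.phi' y.1)

/-- ORTHOGONALITY OF THE TRANSPORTER: `|ψ(z₀) − U(B̃(Γ′_{z₀,y}))φ(y)| = |φ(y) − U(B̃(Γ′_{z₀,y}))ᵀψ(z₀)| = |φ(y) − (Q*(B̃)ψ)(y)|`
(`U = U(κ·B̃(Γ′))` is a value of the orthogonal flow; p. 605 of Part I «unitary operators»). [cite: Balaban1982Higgs2, (2.16) p. 560, (2.113) p. 581] -/
theorem siteNorm_restr216_eq (y : ↥(boxDom (M2 fr.ℓ m.M'))) :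
    siteNorm (m.ψ m.z₀ - transU d fr.F m.κ fr.ℓ m.k m.M' m.emb' m.Γ' m.At m.z₀ y *ᵥ m.φ y)
      = siteNorm (m.φ y - m.target y) := by
  dsimp only [Model27.target, transU]
  rw [transport_fieldLink]
  set t : ℝ := m.κ * lsum m.At (m.emb' m.z₀) (m.Γ' m.z₀ y) with ht
  rw [fr.F.transpose_eq]
  have h : m.ψ m.z₀ - fr.F.U t *ᵥ m.φ y = fr.F.U t *ᵥ (fr.F.U (-t) *ᵥ m.ψ m.z₀ - m.φ y) := by
    rw [mulVec_sub, mulVec_mulVec, ← fr.F.map_add, add_neg_cancel, fr.F.map_zero, one_mulVec]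
  rw [h, siteNorm_flow, ← siteNorm_neg, neg_sub]

/-- **(2.114) AT A UNIT SITE OF `B(z₀)`** from the two printed inputs: (2.16)₁ (`c₂·p`) and the Lemma 2.7 bound `dev2113 ≤ C·p`
(triangle inequality `φ′ = (φ − Q*ψ) + (Q*ψ − aL⁻²C_{Λ₄}Q*ψ)`). [cite: Balaban1982Higgs2, (2.114) p. 581] -/
theorem phi'_site_le {c₂ C : ℝ} (h216 : m.Restr216 c₂) (h27 : m.dev2113 ≤ C * m.p)
    (y : ↥(boxDom (M2 fr.ℓ m.M'))) (hy : cSite d fr.ℓ m.M' y = m.z₀) :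
    siteNorm (m.phi' y) ≤ (c₂ + C) * m.p := by
  have h1 : siteNorm (m.φ y - m.target y) ≤ c₂ * m.p := by
    rw [← m.siteNorm_restr216_eq y]; exact h216 y hy
  have h2 : siteNorm (m.target y - m.objΩ y) ≤ C * m.p := by
    rw [← siteNorm_neg, neg_sub]
    refine le_trans ?_ h27
    exact le_ciSup (f := fun y' : {y' : ↥(boxDom (M2 fr.ℓ m.M')) // cSite d fr.ℓ m.M' y' = m.z₀} =>
      siteNorm (m.objΩ y'.1 - m.target y'.1)) (Set.finite_range _).bddAbove ⟨y, hy⟩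
  have hsplit : m.phi' y = (m.φ y - m.target y) + (m.target y - m.objΩ y) := by
    unfold phi'; abel
  rw [hsplit]
  calc siteNorm ((m.φ y - m.target y) + (m.target y - m.objΩ y))
      ≤ siteNorm (m.φ y - m.target y) + siteNorm (m.target y - m.objΩ y) := siteNorm_add_le _ _
    _ ≤ c₂ * m.p + C * m.p := add_le_add h1 h2
    _ = (c₂ + C) * m.p := by ring

/-- the supremum form over the block `B(z₀)`: `sup |φ′| ≤ (c₂ + C)·p` (for `c₂ + C ≥ 0`). [cite: Balaban1982Higgs2, (2.114) p. 581] -/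
theorem supφ'_le {c₂ C : ℝ} (hc : 0 ≤ c₂ + C) (h216 : m.Restr216 c₂) (h27 : m.dev2113 ≤ C * m.p) :
    m.supφ' ≤ (c₂ + C) * m.p :=
  Real.iSup_le (fun y => m.phi'_site_le h216 h27 y.1 y.2) (mul_nonneg hc m.p_nonneg)

/-- **(2.114) WITH THE EXPLICIT CONSTANT** of p23's reconstruction: under the restrictions, `sup_{B(z₀)}|φ′| ≤ (c₂ + K₃·C27)·p(Lᵏε)`.
[cite: Balaban1982Higgs2, (2.114) p. 581] -/
theorem supφ'_le_explicit {c₂ : ℝ} (hc₂ : 0 ≤ c₂) (hR : m.Restr c₂) :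
    m.supφ' ≤ (c₂ + fr.K₃ * fr.C27) * m.p :=
  m.supφ'_le (add_nonneg hc₂ (mul_nonneg fr.K₃_nonneg fr.C27_nonneg)) hR.2 (lemma27_bound fr Yo m.toModel27 hR.1)

end Model2114

/-- **ROW B2.Eq2.114 — «LEMMA 2.7 AND THE RESTRICTIONS ON THE FIELDS ψ, φ IMPLY (2.114)», AS AN IMPLICATION BETWEEN THE DECLS OF
RECORD, on the concrete model family**: `Lemma27Printed (famOf27 fr Yo)` (row B2.Lem2.7's decl of record on p23's family) ⇒
`Ineq2114` for the family `Model2114 fr Yo` under the restrictions `Model27.Restr ∧ (2.16)₁`, with O(1) = `c₂ + C⁺`.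
[cite: Balaban1982Higgs2, (2.114) p. 581] -/
theorem ineq2114_of_lemma27_model27 (fr : Frame27 ι d) (Yo : Type) [Fintype Yo] [DecidableEq Yo] {c₂ : ℝ} (hc₂ : 0 ≤ c₂)
    (h27 : B2Sect2Statements.Lemma27Printed (famOf27 fr Yo)) :
    B2Sect2Statements.Ineq2114 (fun m : Model2114 fr Yo => m.p) (fun m => m.supφ') (fun m => m.Restr c₂) := by
  obtain ⟨C, hC⟩ := h27
  refine ⟨c₂ + max C 0, fun m hR => ?_⟩
  have hdev : m.dev2113 ≤ max C 0 * m.p :=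
    (hC m.toModel27 hR.1).trans (mul_le_mul_of_nonneg_right (le_max_left _ _) m.p_nonneg)
  exact m.supφ'_le (add_nonneg hc₂ (le_max_right _ _)) hR.2 hdev

/-- **ROW B2.Eq2.114 — (2.114) HYPOTHESIS-FREE ON THE MODEL FAMILY**: the decl of record `B2Sect2Statements.Ineq2114` PROVED for
`Model2114 fr Yo` (every frame, every `c₂ ≥ 0`), Lemma 2.7 being supplied by p23's `lemma27Printed_model` (row B2.Lem2.7,
`proved p252891`). [cite: Balaban1982Higgs2, (2.114) p. 581] -/
theorem ineq2114_model27 (fr : Frame27 ι d) (Yo : Type) [Fintype Yo] [DecidableEq Yo] {c₂ : ℝ} (hc₂ : 0 ≤ c₂) :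
    B2Sect2Statements.Ineq2114 (fun m : Model2114 fr Yo => m.p) (fun m => m.supφ') (fun m => m.Restr c₂) :=
  ineq2114_of_lemma27_model27 fr Yo hc₂ (lemma27Printed_model fr Yo)

/-- the printed instance `c₂ = 2Ld` of (2.16)₁ — on the model's unit lattice of dimension `d+1` with block side `L = ℓ+1`:
`c₂ := 2(ℓ+1)(d+1)`. [cite: Balaban1982Higgs2, (2.16) p. 560 «≦ 2Ldp(ε)», (2.114) p. 581] -/
theorem ineq2114_model27_printed (fr : Frame27 ι d) (Yo : Type) [Fintype Yo] [DecidableEq Yo] :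
    B2Sect2Statements.Ineq2114 (fun m : Model2114 fr Yo => m.p) (fun m => m.supφ')
      (fun m => m.Restr (2 * ((fr.ℓ : ℝ) + 1) * ((d : ℝ) + 1))) :=
  ineq2114_model27 fr Yo (by positivity)

end Literature.MathematicalPhysics.QuantumFieldTheory.Balaban1983to89.B2Ineq2114Model27

end
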